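import Summits.CriticalPhenomena.SAWScalingLimit.Theses.SAWRenewalTightness
import Literature.Probability.RandomPlanarGeometry.BDGS2012Proofs
import Literature.Probability.RandomPlanarGeometry.BDGS2012CountBoundsProofs
import Literature.Probability.RandomPlanarGeometry.SAWBridges
import Literature.Probability.LatticeModels.LatticeDobrushinDomain

/-!
# Disproof of `AnnularMassDecay` (crux `stmt-CriticalPhenomena-4729`, route `SAWRenewalTightness` r3) — standing adversary's work file

The crux (lattice units on `ℤ²`, `x_c = SAW.criticalFugacity = 1/μ`):
`∃ θ > 0, C, ∀ z r R, 1 ≤ r → r < R → ∀ u, R ≤ |u - z| → ∀ N,`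
`annMass z r R u N := Σ_{n ≤ N} Σ_{ω ∈ saws 2 n, interior in r < |· - z| < R, end in |· - z| ≤ r} x_c ^ n ≤ C (r/R)^θ`
(`annularMassDecay_iff` below certifies that `annMass` is literally the crux's double sum).

## Findings (cycle 2, 2026-08-16, gen-2 seat) — newest first

VERDICT: still no kill; the crux keeps resisting for the structural reason recorded in cycle 1 (a
counterexample needs a LOWER bound on critical `x_c`-masses beating every power of `R/r`).  New
checked content and numerics:

* §A'' `annularMassDecay_false_without_avoidInner` (sorry-free; LANDED as
  `Theorems/AnnularMassDecay/Negative/HalfPlaneDivergence.lean` p76222 + `…/Negative/AvoidInner.lean`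
  p76764, importable): the INNER half of the annulus clause
  (`r < dist (u + ω i) z` for interior `i`) is load-bearing.  Drop it (interior may enter the target
  disc, outer confinement and endpoint clause kept) and the statement is FALSE: at `z = 0`, `R = m`,
  `r = m - 1`, `u = (m, 0)` every half-plane walk of length `≤ √m`, reflected and hung below the first
  inward step, is counted, so the mass is `≥ x_c · H_{⌊√m⌋}` where `H_K = Σ_{k≤K} h_k x_c^k`, and
  `halfPlanePartialSum_unbounded : ∀ B, ∃ K, B < H_K` (finitary Madras–Slade Cor. 3.1.8, proved here
  from `μ^n ≤ c_n` and `c_n ≤ Σ_m h_{m+1} h_{n-m}`, both in tree).  MORAL: together with §A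
  (`false_without_endInside`) this pins the mechanism any proof must exploit — the counted family is
  PREFIX-FREE (first entrance) AND bridge-like (interior squeezed strictly between the start radius and
  the end radius); remove either and the half-plane divergence `H(x_c) = ∞` enters.  By-product for
  provers/ideators: `one_le_count_mul_pow` (`c_n x_c^n ≥ 1`), `sum_count_mul_pow_le`
  (`Σ_{n≤M} c_n x_c^n ≤ x_c⁻¹ H_{M+1} H_M`), `triangle_sum_le`, `hang`/`hang_mem_saws` (reflect-and-hang
  embedding of half-plane walks into disc-confined walks from a boundary point).
* §I `annMass_eq_zero_of_far`, `annMass_stable`, `annMass_le_annMass_stable` (sorry-free; LANDED as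
  `Theorems/AnnularMassDecay/Negative/Structure.lean` p77130): far starts (`|u - z| ≥ R + 1`) contribute `0`; the partial sums are constant
  from `N₀ = (2⌈R⌉+3)² + 1` on, so `∀ N` ⇔ `N = N₀` and each instance is a finite family of walks
  (useful for finite-configuration inductions such as the renewal cards propose, and for exact checks).
* §D' NUMERICS v2 (C enumerator `annmass2.c`: exact DFS + PERM, validated against cycle-1 exact values
  `M(1,2)=x_c`, `M(2,4)=0.2701707`, `M(1,3)=0.2545635`, `M(1,4)=0.1900334` and PERM↔DFS agreement to 4·10⁻⁵;
  local confirm runs 150–300 s; kit jobs j010831 (medium table), j010832/j010833 (full RKI scan / full crux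
  table) attach `summary.txt` to the item when they land; errors 1σ over 64 tour blocks):
  - aspect 2, `z = 0`, on-axis start: `M(4,8) = 0.21060(7)`, `M(16,32) = 0.1441(2)`, `M(32,64) = 0.1219(5)`;
    `M·r^{1/4} = 0.298, 0.288, 0.290` — the cycle-1 law `M(r,2r) ≈ 0.29 r^{-1/4}` (DEcreasing in r) now holds
    to r = 32; the route's falsifier ("mass increasing in r") does not fire.
  - θ-direction at `r = 1`: `M(1,16) = 0.05995(8)`, `M(1,32) = 0.03525(9)`, `M(1,64) = 0.0209(5)`: local
    exponents `log₂(M(1,R)/M(1,2R)) = 0.766 (R=16), 0.757 (R=32)` (cycle 1 saw ≈ 0.9 at R ≤ 32 for r = 4;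
    drifting DOWN towards the predicted `35/48 = 0.729`); `M(2,64) = 0.0287(3)`.  Any θ ≤ 0.7 remains
    consistent with all data.
  - sup-scan (exact DFS) over `z ∈ {0,(½,½),(½,0)}`, `r ≤ 2`, `R - r ∈ {0.5, 1.01, 2}`, all lattice starts:
    max `M = x_c + x_c² + x_c³ = 0.577` (a tangential corridor feeding three successive entries: z=(½,0),
    r=2, R=2.5, u=(2,2)), below cycle 1's corner value `2x_c = 0.758`, which stays the largest mass seen.
* §A‴ (heuristic, NOT certified — recorded so nobody tries to drop it) OUTER CONFINEMENT is load-bearing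
  too: without `dist (u + ω i) z < R` for interior `i` the counted family is "all first-entry prefixes into
  `B̄(z,r)` from a BULK point `u`", whose mass at `|u - z| = 2r` is `Σ_{v ∈ ∂B} G_{ℂ∖B̄}(u,v) ≍ r · r^{-(x₁+x_b)}
  = r^{1 - 5/48 - 5/8} = r^{13/48} → ∞` (bulk one-leg `x₁ = 5/48` at the start instead of the boundary `x_b =
  5/8` that confinement enforces; the crux's own count is `r · r^{-2x_b} = r^{-1/4}`).  So the variant is
  predicted FALSE by a wide margin (`x₁ + x_b = 35/48 < 1`), but a proof needs a polynomial LOWER bound on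
  bulk-to-ball `x_c`-masses — the same missing technology as r4 `TubeLowerBound`; bridge families only
  certify `F ≳ u_{d+1}` per configuration (no growth).  Not filed as a theorem.
* §H IDEA-LEVEL NEGATIVE (for the triage panel / lead; not about the crux's truth): the RADIAL KESTEN
  INEQUALITY `RadialKestenInequality` of card `radial-renewal-kesten-inequality`
  (`Cruxes/AnnularMassDecay/SketchIdeator1.lean`: x_c-mass `k_in(u; R, z)` of radially irreducible descents
  from `u` confined to `|· - z| < R`, `R ≤ |u - z|`, claimed `≤ 1` for ALL `z ∈ ℂ`, `R`, `u`) is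
  NUMERICALLY FALSE.  The enumerator reproduces the ideator's exact on-lattice values (`k_in = 0.758105,
  0.427125, 0.776327, 0.836553, 0.536341, 0.851290` for `z = 0`, `|u|² = 2,4,5,8,9,10`; independent
  brute-force literal check of the Lean predicate, `kin_bruteforce.py`), but an off-lattice centre puts the
  sites of the circle `|v - z| = |u - z|` strictly inside the disc and breaks the distance TIES of `ℤ²`
  (ties block strict records / separations), and the kernel mass then exceeds 1 and GROWS with `R`
  (off-lattice exactness cross-checked: brute force = DFS = 0.8401088194 at z=(-0.01,0.003), u=(2,1)): with `z = (0.01, -0.003)`, `u = (n, 1)`, `R = |u - z|` (PERM, 150–300 s, 1σ):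
      n = 8: `k_in = 1.00802(8)` and `1.00777(8)` (two seeds);  n = 12: `1.0238(1)`;  n = 16: `1.0431(2)`;
      n = 24: `1.0592(3)`;  n = 32: `1.0738(5)` — growing by ≈ 0.03 per doubling of R (log-like);
  also `1.00679(7)` at `z = (0.3, -0.1)`, `u = (8,1)`.  ON-LATTICE (`z = 0`, the ideator's own setting)
  the same starts give `0.9459(8)` (n = 8), `0.9679(1)` (12), `1.0001(3)` (24), **`1.0108(6)` (n = 32,
  R = √1025, 17σ above 1)**: RKI fails for lattice centres too, crossing 1 near `R ≈ 24`.  Plausible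
  mechanism: long linear bridges of span `L ≲ R` launched from `u` are radially irreducible with positive
  probability (the tilted circles through off-axis points destroy linear renewals), and their total mass
  `Σ_{L≤R} u_L ≳ c log R` diverges — the kernel mass inherits a slowly divergent macroscopic part, exactly
  the "honest residue" the card feared (`k(u) = 1 + c R^{-3/4}` was optimistic; the data say `+c·log R`).
  So pointwise sub-stochasticity of the radial renewal kernel FAILS (for every centre, at R ≳ 8 off-lattice,
  R ≳ 24 on-lattice); `RKI_implies_bounded` keeps value only with an AVERAGED or superharmonic-profile
  replacement (the card's fallback — the decay statement in disguise) — which is what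
  remains of that line.  Not certifiable in Lean with in-tree `x_c` bounds (`x_c ≥ 1/2.695` costs
  `0.979^n` per walk of length n, and the excess sits in long walks); filed as numerical evidence.
* §E' LITERATURE: `lit search` still unavailable this cycle (searchd rc 75); nothing new to add to §E.

## Findings (cycle 1, 2026-08-16)

VERDICT SO FAR: no kill.  The statement is the lattice form of the SLE₈/₃ / Coulomb-gas prediction
`annMass ≍ (r/R)^{35/48} · r^{-1/4}` (boundary one-leg exponent 5/8 + bulk one-leg 5/48), so it is
very probably TRUE with any `θ < 35/48`; it resists disproof because every degenerate regime is
harmless (see §B) and a genuine counterexample would need a LOWER bound on critical SAW masses that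
beats every power of `R/r` — i.e. news of the size "2D SAW is not sub-critical-like in annuli".

* §A LOAD-BEARING HYPOTHESES (theorems `false_without_*`, all sorry-free):
  - `R ≤ dist u z` (start on/outside the outer circle) is load-bearing: drop it and the trivial walk
    at `u = z` has mass `1` for every `R` (`false_without_startOutside`).
  - `1 ≤ r` is load-bearing: with only `0 < r` the two-step walk `(2,0) → (1,0) → (0,0)` has mass
    `x_c² > 0` for every `r ∈ (0,1)` at `R = 2` while `C (r/2)^θ → 0` (`false_without_innerRadiusOne`).
    So any proof must use that the target disc has radius ≥ one lattice spacing (the bound is NOT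
    scale-free below the lattice scale; harmless for the surgery, which only uses `r ≥ δ`-shells).
  - the endpoint clause `dist (u + ω n) z ≤ r` is load-bearing: drop it and the one-step walks from
    `u` already give mass `≥ x_c` for every `R` (`false_without_endInside`).
  - `r < R` is NOT load-bearing: it can be replaced by `0 < R` (`annularMassDecay_iff_posR`): for
    `R ≤ r` the annulus is empty, only walks of length ≤ 1 survive and `annMass ≤ 5 ≤ 5 (r/R)^θ`.
    (Information for the prover: nothing in the statement lives at aspect ratio near 1.)
* §B DEGENERATE / LIMIT REGIMES CHECKED BY HAND (no kill; recorded so nobody redoes them):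
  - `n = 0` never counts (needs `|u - z| ≤ r < R ≤ |u - z|`); `n = 1` contributes ≤ `4 x_c ≤ 2`.
  - thin annuli `R - r < 1` at large radius are NOT empty: near the axes the annulus contains straight
    lattice runs of length `≍ √(2 r (R - r))`, but they are quasi-one-dimensional and their mass is a
    geometric series `≤ x_c²/(1 - x_c) · O(1)`; numerics (§D) confirm `annMass` stays `< 0.4` there.
  - `z ∉ ℤ²`, `r = 1`: the target disc holds 1–4 sites, all masses `O(x_c)`.
  - `R → ∞` at `r = 1`, `z ∈ ℤ²`: heuristically `annMass ≍ R^{-35/48}`; a disproof here would need a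
    polynomial LOWER bound on point-to-boundary critical masses — exactly the open crux r4
    (`TubeLowerBound`) in reverse, not available.
* §B' TIGHTNESS AT THE SMALLEST SCALE (theorem `const_ge_of_bound`): any admissible pair has
  `C ≥ x_c · 2^θ` (the one-step bridge `(2,0) → (1,0)` at `r = 1, R = 2`); §G `annMass_translate`:
  the mass is invariant under translating `z` and `u` by a lattice vector (WLOG `z ∈ [0,1)²`).
* §C NATURAL STRENGTHENINGS (status):
  - `θ ≥ 1`?  Not refutable with in-tree tools (needs lower bounds on `x_c`-masses); prediction says
    the optimal `θ` is `35/48 < 1`, so `θ = 1` SHOULD be false but we cannot certify it.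
  - all-`x` version (`x > x_c`): false (masses of a fixed annulus are finite but grow like
    `(x μ_A)^{n}`-sums; as `R → ∞`, `μ_A → μ` and the mass from a point diverges) — not formalised,
    it is the catalogued barrier `SupercriticalSAWSpaceFilling`, which the crux evades by sitting at `x_c`.
* §D NUMERICS (the route's CHEAPEST FALSIFIER, run here; C program `annmass.c`: exact DFS enumeration for
  small annuli + PERM (pruned-enriched Rosenbluth, unbiased, exact last step into the disc) for large ones;
  `x_c = 0.379052277`; kit jobs j007829 (cancelled, queue) → j007994 (4 cores; full table lands in
  `~/compute/j007994/outputs/summary.txt` and is attached to the item as evidence); provisional values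
  from short local runs, errors are 1σ over independent tours):
  - fixed aspect ratio `R = 2r`, `z = 0`, on-axis start `u = (R,0)`:
      r=1: 0.37905 (exact, = x_c: the single walk (2,0)→(1,0));  r=2: 0.27017 (exact, DFS complete);
      r=4: 0.2104(6);  r=8: 0.1759(15);  r=16: 0.1464(31);  r=32: 0.07(1) (few tours, PERM under-samples).
      `M · r^{1/4}` = 0.321, 0.2975, 0.2958, 0.2928 for r = 2, 4, 8, 16: FLAT, i.e. `M ≈ 0.295 r^{-1/4}` —
      exactly the predicted `r^{-1/4}` (two boundary legs `2·5/8` minus one summed endpoint).  DECREASING in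
      r: the falsifier ("mass increasing in r kills r3") does NOT fire.
  - fixed `r = 4`, growing `R` (the θ-direction): R=8: 0.2104, R=16: 0.1139(16), R=32: 0.060(4):
      factor ≈ 0.53–0.54 per doubling, i.e. `M ~ R^{-0.9}` at these sizes (prediction `R^{-35/48} = R^{-0.73}`
      asymptotically); any `θ ≤ 0.7` looks safe.  r=1: M(1,2)=0.379, M(1,3)=0.2546, M(1,4)=0.1900 (exact).
  - thin annuli (the only regime where `(r/R)^θ ≈ 1`, so UNIFORM BOUNDEDNESS is what is tested; a mass
      growing without bound in r here would kill the crux): width 1.5, on-axis start, r = 4, 8, 16, 32,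
      64, 128, 256: M = 0.2800(5), 0.3008(3), 0.3098(4), 0.3135(4), 0.3164(4), 0.3167(4), 0.3170(4) —
      increasing but SATURATING (increments 0.021, 0.009, 0.004, 0.003, 0.0003, 0.0003 ≈ curvature
      corrections O(1/r)) to the straight-strip value ≈ 0.318 < 1 = Kesten's bound; width 3, r = 8, 32,
      128: 0.2664(9), 0.2828(9), 0.2847(10), saturating ≈ 0.286.  Quasi-1D as expected; no kill.
  - entry geometry matters by O(1): for (8,16), off-axis `u = (12,11)` (two inward neighbours) gives
      0.254(3) vs 0.176 on-axis (one inward neighbour).  The sup over `u, z` is absorbed by `C`.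
  - exhaustive scan of SMALL configurations (z ∈ {0,¼,½}² reps, r ∈ [1,3], R − r ∈ [0.3,3], all starts u;
      4712 exact/truncated DFS runs, `scan_small.py`): the largest mass is `2 x_c = 0.758`, attained by
      CORNER entries into thin annuli (e.g. z = 0, r = 2.5, R = 2.8, u = (2,2): both inward neighbours
      (1,2), (2,1) lie in the target disc; a third neighbour in the disc is impossible since opposite
      neighbours in `|· - z| ≤ r` force `|u - z| < r`).  So numerically `C = 1` works for every θ ≤ 1/2
      on all data gathered (binding value 0.80 at the corner configuration), and `C ≥ 2 x_c` is necessary.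
* §E LITERATURE (held copy of MadrasSlade1993, PDF pages): p.107 (=book p.92, §4.2 after Thm 4.2.2):
  "it is believed that lim_N b_N/μ^N = 0, but there is no known proof of this" (bridges by LENGTH; the
  span-renewal `u_L ≤ 1` is the theorem behind StripMassConservation); p.92 (=book p.77, Ch. 4 intro):
  "it is not even known rigorously that G_{z_c}(0,x) is finite for any x ≠ 0 in low dimensions".
  CALIBRATION: uniform boundedness of `annMass z 1 R u` in `R` (the θ = 0 content of the crux at r = 1)
  is a restricted — disc-confined, stopped at the first entry of the unit disc — version of
  `G_{z_c}(u, z) < ∞`; neither formally implies the other, but apart from Kesten's renewal bound for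
  bridges in a STRIP (`u_L ≤ 1`, the route's starting point) no technique in print bounds critical
  point-to-set `x_c`-masses on `ℤ²` uniformly in the size of the confining domain (on the hexagonal
  lattice the parafermionic observable does exactly this), which is why even θ = 0 is open here.  So a
  PROOF of the crux needs a new uniform bound of that kind, and a DISPROOF would need a lower bound on
  critical masses beating every power of `R/r`, i.e. a failure of SLE₈/₃ scaling for the
  `ℤ²` SAW.  No negative result of either kind is in print (searchd was unavailable this cycle for the
  remote cascade; local: MS93, BDGS2012 lecture notes, `ledger negatives` (8 items, none on SAW masses),
  barrier catalogue: `SupercriticalSAWSpaceFilling` (DKY Problem 10 "show γ_δ is not space-filling at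
  x = 1/μ" is OPEN — the whole route would solve it), `SAWNotKineticallyGrown`, `NienhuisWeightsExcludeVertexSAW`
  (why the hexagonal bridge-decay proofs do not transfer)).
* §F WHAT A PROVER SHOULD TAKE FROM THIS FILE: (i) use `1 ≤ r` and the endpoint clause essentially
  (§A); (ii) `r < R` is cosmetic (§A'); (iii) the true decay is `≈ (r/R)^{0.73} r^{-1/4}`, so there is
  room: any θ ∈ (0, 0.7] and no `r`-decay needed; (iv) the binding configurations for `C` are the
  smallest ones (r = 1, R ≤ 2, |u| = R on an axis); (v) even θ = 0 (uniform boundedness) is open and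
  already of "G_{z_c} finite" strength — do not expect to get θ > 0 cheaply from θ = 0 by
  submultiplicativity: annular bridges do NOT concatenate submultiplicatively (after the first entry
  into `|·| ≤ r'` the walk may leave again), which is exactly where the route's surgery is needed.

Everything conclusive here is sorry-free; near-misses (if any) are marked `sorry` with the obstruction.
-/

namespace Summit.CriticalPhenomena.SAWScalingLimit.Cruxes.AnnularMassDecay.Disproof

open Literature.Probability.RandomPlanarGeometry Literature.Probability.LatticeModels Filter Topology
open scoped BigOperators Classical
open Summit.CriticalPhenomena.SAWScalingLimit.Theses.SAWRenewalTightness (AnnularMassDecay)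

noncomputable section

/-! ### The crux's sum, named -/

/-- The annular-bridge partial sum of the crux: `x_c`-mass of SAWs of length `≤ N` from `u` whose
interior vertices lie in the open annulus `r < |· - z| < R` and whose endpoint lies in `|· - z| ≤ r`.
[this work file] -/
def annMass (z : ℂ) (r R : ℝ) (u : Site 2) (N : ℕ) : ℝ :=
  ∑ n ∈ Finset.range (N + 1), ∑ _ω ∈ (SAW.Zd.saws 2 n).filter (fun ω =>
    (∀ i, 0 < i → i < n → r < dist (Site.toComplex (u + ω i)) z ∧
      dist (Site.toComplex (u + ω i)) z < R) ∧ dist (Site.toComplex (u + ω n)) z ≤ r),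
      SAW.criticalFugacity ^ n

/-- `annMass` is literally the double sum of the crux. -/
theorem annularMassDecay_iff :
    AnnularMassDecay ↔ ∃ θ C : ℝ, 0 < θ ∧ ∀ (z : ℂ) (r R : ℝ), 1 ≤ r → r < R →
      ∀ u : Site 2, R ≤ dist (Site.toComplex u) z → ∀ N : ℕ, annMass z r R u N ≤ C * (r / R) ^ θ :=
  Iff.rfl

/-! ### Basic facts -/

/-- `0 < x_c` (`x_c = 1/μ`, `μ ≥ 1`). [folklore] -/
theorem criticalFugacity_pos : 0 < SAW.criticalFugacity := by
  have h := SAW.Zd.criticalPoint_pos 2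
  rwa [SAW.Zd.criticalPoint_two] at h

/-- `x_c ≤ 1` (`μ ≥ 1`). [folklore] -/
theorem criticalFugacity_le_one : SAW.criticalFugacity ≤ 1 := by
  have h := SAW.Zd.one_le_connectiveConstant 2
  rw [SAW.Zd.connectiveConstant_two] at h
  unfold SAW.criticalFugacity
  exact inv_le_one_of_one_le₀ h

/-- The annular mass is a sum of nonnegative terms. [folklore] -/
theorem annMass_nonneg (z : ℂ) (r R : ℝ) (u : Site 2) (N : ℕ) : 0 ≤ annMass z r R u N :=
  Finset.sum_nonneg fun n _ => Finset.sum_nonneg fun _ _ => pow_nonneg criticalFugacity_pos.le n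

/-- One admissible walk of length `n ≤ N` already contributes `x_c ^ n`. -/
theorem pow_le_annMass {z : ℂ} {r R : ℝ} {u : Site 2} {N n : ℕ} (hn : n ≤ N) {ω : ℕ → Site 2}
    (hω : ω ∈ SAW.Zd.saws 2 n)
    (hint : ∀ i, 0 < i → i < n → r < dist (Site.toComplex (u + ω i)) z ∧
      dist (Site.toComplex (u + ω i)) z < R)
    (hend : dist (Site.toComplex (u + ω n)) z ≤ r) :
    SAW.criticalFugacity ^ n ≤ annMass z r R u N := by
  unfold annMass
  have hx : 0 ≤ SAW.criticalFugacity := criticalFugacity_pos.le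
  calc SAW.criticalFugacity ^ n
      ≤ ∑ _ω ∈ (SAW.Zd.saws 2 n).filter (fun ω =>
          (∀ i, 0 < i → i < n → r < dist (Site.toComplex (u + ω i)) z ∧
            dist (Site.toComplex (u + ω i)) z < R) ∧ dist (Site.toComplex (u + ω n)) z ≤ r),
          SAW.criticalFugacity ^ n :=
        Finset.single_le_sum (f := fun _ => SAW.criticalFugacity ^ n) (fun _ _ => pow_nonneg hx n)
          (Finset.mem_filter.2 ⟨hω, hint, hend⟩)
    _ ≤ _ := Finset.single_le_sum
          (f := fun m => ∑ _ω ∈ (SAW.Zd.saws 2 m).filter (fun ω =>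
            (∀ i, 0 < i → i < m → r < dist (Site.toComplex (u + ω i)) z ∧
              dist (Site.toComplex (u + ω i)) z < R) ∧ dist (Site.toComplex (u + ω m)) z ≤ r),
            SAW.criticalFugacity ^ m)
          (fun m _ => Finset.sum_nonneg fun _ _ => pow_nonneg hx m)
          (Finset.mem_range.2 (Nat.lt_succ_of_le hn))

/-! ### Concrete sites and walks on the real axis -/

/-- The site `(k, 0)`. -/
def ax (k : ℤ) : Site 2 := ![k, 0]

/-- `(k, 0) ↦ k ∈ ℂ`. [folklore] -/
theorem toComplex_ax (k : ℤ) : Site.toComplex (ax k) = (k : ℂ) := by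
  apply Complex.ext <;> simp [Site.toComplex, ax]

/-- `|(k,0)| = |k|`. [folklore] -/
theorem dist_ax_zero (k : ℤ) : dist (Site.toComplex (ax k)) 0 = |(k : ℝ)| := by
  rw [toComplex_ax, dist_zero_right]
  simp

/-- Addition on the axis. [folklore] -/
theorem ax_add (a b : ℤ) : ax a + ax b = ax (a + b) := by
  funext j; fin_cases j <;> simp [ax]

/-- `(0,0) = 0`. [folklore] -/
theorem ax_zero : ax 0 = 0 := by
  funext j; fin_cases j <;> simp [ax]

/-- The origin embeds to `0`. [folklore] -/
theorem toComplex_zero : Site.toComplex 0 = 0 := by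
  apply Complex.ext <;> simp [Site.toComplex]

/-- The trivial walk. -/
theorem const_zero_mem_saws : (fun _ => (0 : Site 2)) ∈ SAW.Zd.saws 2 0 := by
  rw [SAW.Zd.mem_saws]
  exact ⟨rfl, fun _ _ => rfl, fun i hi => absurd hi (Nat.not_lt_zero i),
    fun i hi j hj _ => (Nat.le_zero.1 hi).trans (Nat.le_zero.1 hj).symm⟩

/-- The one-step walk `0 → e₀`, frozen afterwards. -/
def ω₁ : ℕ → Site 2
  | 0 => ax 0
  | _ => ax 1

/-- `ω₁` is a one-step SAW from `0`. [folklore] -/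
theorem ω₁_mem : ω₁ ∈ SAW.Zd.saws 2 1 := by
  rw [SAW.Zd.mem_saws]
  refine ⟨ax_zero, ?_, ?_, ?_⟩
  · intro i hi
    obtain ⟨k, rfl⟩ := Nat.exists_eq_add_of_le' hi
    rfl
  · intro i hi
    interval_cases i
    show (zdGraph 2).Adj (ax 0) (ax 1)
    rw [zdGraph_adj_iff]; exact ⟨0, Or.inl (by funext j; fin_cases j <;> simp [ax])⟩
  · intro i hi j hj h
    simp only [Set.mem_setOf_eq] at hi hj
    have key : ∀ i ≤ 1, ∀ j ≤ 1, ω₁ i 0 = ω₁ j 0 → i = j := by decide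
    exact key i hi j hj (by rw [h])

/-- The two-step walk `0 → -e₀ → -2e₀`, frozen afterwards. -/
def ω₂ : ℕ → Site 2
  | 0 => ax 0
  | 1 => ax (-1)
  | _ => ax (-2)

/-- `ω₂` is a two-step SAW from `0`. [folklore] -/
theorem ω₂_mem : ω₂ ∈ SAW.Zd.saws 2 2 := by
  rw [SAW.Zd.mem_saws]
  refine ⟨ax_zero, ?_, ?_, ?_⟩
  · intro i hi
    obtain ⟨k, rfl⟩ := Nat.exists_eq_add_of_le' hi
    rfl
  · intro i hi
    interval_cases i
    · show (zdGraph 2).Adj (ax 0) (ax (-1))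
      rw [zdGraph_adj_iff]; exact ⟨0, Or.inr (by funext j; fin_cases j <;> simp [ax])⟩
    · show (zdGraph 2).Adj (ax (-1)) (ax (-2))
      rw [zdGraph_adj_iff]; exact ⟨0, Or.inr (by funext j; fin_cases j <;> simp [ax])⟩
  · intro i hi j hj h
    simp only [Set.mem_setOf_eq] at hi hj
    have key : ∀ i ≤ 2, ∀ j ≤ 2, ω₂ i 0 = ω₂ j 0 → i = j := by decide
    exact key i hi j hj (by rw [h])

/-- `C (1/R)^θ → 0` as `R → ∞` (`θ > 0`). -/
theorem tendsto_const_mul_one_div_rpow {θ : ℝ} (hθ : 0 < θ) (C : ℝ) :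
    Tendsto (fun R : ℝ => C * (1 / R) ^ θ) atTop (𝓝 0) := by
  have h := ((tendsto_rpow_atTop hθ).inv_tendsto_atTop).const_mul C
  rw [mul_zero] at h
  refine h.congr' ?_
  filter_upwards [eventually_ge_atTop 0] with R hR
  simp [one_div, Real.inv_rpow hR]

/-! ### §A Load-bearing hypotheses -/

/-- The crux with `R ≤ dist u z` (start on/outside the outer circle) DROPPED. -/
def WithoutStartOutside : Prop :=
  ∃ θ C : ℝ, 0 < θ ∧ ∀ (z : ℂ) (r R : ℝ), 1 ≤ r → r < R → ∀ u : Site 2, ∀ N : ℕ,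
    annMass z r R u N ≤ C * (r / R) ^ θ

/-- Any proof of the crux must use `R ≤ dist u z`: without it the trivial walk at `u = z = 0`
is an "annular bridge" of mass `1` for every `R`, while `C (1/R)^θ → 0`. -/
theorem false_without_startOutside : ¬ WithoutStartOutside := by
  rintro ⟨θ, C, hθ, h⟩
  have h1 : ∀ R : ℝ, 1 < R → (1 : ℝ) ≤ C * (1 / R) ^ θ := by
    intro R hR
    refine le_trans ?_ (h 0 1 R le_rfl hR 0 0)
    have := pow_le_annMass (z := 0) (r := 1) (R := R) (u := 0) (N := 0) (n := 0) le_rfl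
      const_zero_mem_saws (fun i _ hin => absurd hin (Nat.not_lt_zero i))
      (by rw [add_zero, toComplex_zero, dist_self]; exact zero_le_one)
    simpa using this
  obtain ⟨R, hR1, hR2⟩ := ((eventually_gt_atTop 1).and
    ((tendsto_const_mul_one_div_rpow hθ C).eventually (gt_mem_nhds one_pos))).exists
  exact lt_irrefl _ ((h1 R hR1).trans_lt hR2)

/-- The crux with `1 ≤ r` WEAKENED to `0 < r`. -/
def WithoutInnerRadiusOne : Prop :=
  ∃ θ C : ℝ, 0 < θ ∧ ∀ (z : ℂ) (r R : ℝ), 0 < r → r < R → ∀ u : Site 2,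
    R ≤ dist (Site.toComplex u) z → ∀ N : ℕ, annMass z r R u N ≤ C * (r / R) ^ θ

/-- Any proof of the crux must use `1 ≤ r`: for `0 < r < 1`, `z = 0`, `R = 2`, `u = (2,0)` the walk
`(2,0) → (1,0) → (0,0)` is an annular bridge of mass `x_c²`, but `C (r/2)^θ → 0` as `r → 0⁺`. -/
theorem false_without_innerRadiusOne : ¬ WithoutInnerRadiusOne := by
  rintro ⟨θ, C, hθ, h⟩
  have h1 : ∀ r : ℝ, 0 < r → r < 1 → SAW.criticalFugacity ^ 2 ≤ C * (r / 2) ^ θ := by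
    intro r hr0 hr1
    have hu : (2 : ℝ) ≤ dist (Site.toComplex (ax 2)) 0 := by rw [dist_ax_zero]; norm_num
    refine le_trans ?_ (h 0 r 2 hr0 (by linarith) (ax 2) hu 2)
    refine pow_le_annMass le_rfl ω₂_mem ?_ ?_
    · intro i hi0 hi2
      obtain rfl : i = 1 := by omega
      show r < dist (Site.toComplex (ax 2 + ax (-1))) 0 ∧ dist (Site.toComplex (ax 2 + ax (-1))) 0 < 2
      rw [ax_add, dist_ax_zero]; norm_num; exact hr1
    · show dist (Site.toComplex (ax 2 + ax (-2))) 0 ≤ r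
      rw [ax_add, dist_ax_zero]; norm_num; exact hr0.le
  have ht : Tendsto (fun r : ℝ => C * (r / 2) ^ θ) (𝓝[>] 0) (𝓝 0) := by
    have hc : Continuous fun r : ℝ => C * (r / 2) ^ θ :=
      continuous_const.mul ((continuous_id.div_const 2).rpow_const fun _ => Or.inr hθ.le)
    have := hc.tendsto 0
    simp only [zero_div, Real.zero_rpow hθ.ne', mul_zero] at this
    exact tendsto_nhdsWithin_of_tendsto_nhds this
  have hx2 : 0 < SAW.criticalFugacity ^ 2 := pow_pos criticalFugacity_pos 2
  have e1 : ∀ᶠ r in 𝓝[>] (0 : ℝ), 0 < r := self_mem_nhdsWithin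
  have e2 : ∀ᶠ r in 𝓝[>] (0 : ℝ), r < 1 := mem_nhdsWithin_of_mem_nhds (Iio_mem_nhds one_pos)
  obtain ⟨r, hr0, hr1, hr2⟩ := (e1.and (e2.and (ht.eventually (gt_mem_nhds hx2)))).exists
  exact lt_irrefl _ ((h1 r hr0 hr1).trans_lt hr2)

/-- The crux's sum with the endpoint clause `dist (u + ω n) z ≤ r` DROPPED. -/
def annMassNoEnd (z : ℂ) (r R : ℝ) (u : Site 2) (N : ℕ) : ℝ :=
  ∑ n ∈ Finset.range (N + 1), ∑ _ω ∈ (SAW.Zd.saws 2 n).filter (fun ω =>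
    ∀ i, 0 < i → i < n → r < dist (Site.toComplex (u + ω i)) z ∧
      dist (Site.toComplex (u + ω i)) z < R), SAW.criticalFugacity ^ n

/-- The crux with the endpoint clause DROPPED. -/
def WithoutEndInside : Prop :=
  ∃ θ C : ℝ, 0 < θ ∧ ∀ (z : ℂ) (r R : ℝ), 1 ≤ r → r < R → ∀ u : Site 2,
    R ≤ dist (Site.toComplex u) z → ∀ N : ℕ, annMassNoEnd z r R u N ≤ C * (r / R) ^ θ

/-- One admissible walk of length `n ≤ N` contributes `x_c ^ n` (no-endpoint-clause sum). [folklore] -/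
theorem pow_le_annMassNoEnd {z : ℂ} {r R : ℝ} {u : Site 2} {N n : ℕ} (hn : n ≤ N)
    {ω : ℕ → Site 2} (hω : ω ∈ SAW.Zd.saws 2 n)
    (hint : ∀ i, 0 < i → i < n → r < dist (Site.toComplex (u + ω i)) z ∧
      dist (Site.toComplex (u + ω i)) z < R) :
    SAW.criticalFugacity ^ n ≤ annMassNoEnd z r R u N := by
  unfold annMassNoEnd
  have hx : 0 ≤ SAW.criticalFugacity := criticalFugacity_pos.le
  calc SAW.criticalFugacity ^ n
      ≤ ∑ _ω ∈ (SAW.Zd.saws 2 n).filter (fun ω =>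
          ∀ i, 0 < i → i < n → r < dist (Site.toComplex (u + ω i)) z ∧
            dist (Site.toComplex (u + ω i)) z < R), SAW.criticalFugacity ^ n :=
        Finset.single_le_sum (f := fun _ => SAW.criticalFugacity ^ n) (fun _ _ => pow_nonneg hx n)
          (Finset.mem_filter.2 ⟨hω, hint⟩)
    _ ≤ _ := Finset.single_le_sum
          (f := fun m => ∑ _ω ∈ (SAW.Zd.saws 2 m).filter (fun ω =>
            ∀ i, 0 < i → i < m → r < dist (Site.toComplex (u + ω i)) z ∧
              dist (Site.toComplex (u + ω i)) z < R), SAW.criticalFugacity ^ m)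
          (fun m _ => Finset.sum_nonneg fun _ _ => pow_nonneg hx m)
          (Finset.mem_range.2 (Nat.lt_succ_of_le hn))

/-- Any proof of the crux must use the endpoint clause: without it the one-step walk from
`u = (m, 0)` (`z = 0`, `r = 1`, `R = m`) has mass `x_c` for every `m`, while `C (1/m)^θ → 0`. -/
theorem false_without_endInside : ¬ WithoutEndInside := by
  rintro ⟨θ, C, hθ, h⟩
  obtain ⟨a, ha⟩ := Filter.eventually_atTop.1
    ((tendsto_const_mul_one_div_rpow hθ C).eventually (gt_mem_nhds criticalFugacity_pos))
  set m : ℕ := max ⌈a⌉₊ 2 with hm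
  have hma : a ≤ (m : ℝ) := (Nat.le_ceil a).trans (by exact_mod_cast le_max_left _ _)
  have hm2 : (2 : ℝ) ≤ (m : ℝ) := by exact_mod_cast le_max_right _ _
  have hu : (m : ℝ) ≤ dist (Site.toComplex (ax m)) 0 := by
    rw [dist_ax_zero]; simp
  have h1 : SAW.criticalFugacity ≤ C * (1 / (m : ℝ)) ^ θ := by
    refine le_trans ?_ (h 0 1 m le_rfl (by linarith) (ax m) hu 1)
    have := pow_le_annMassNoEnd (z := 0) (r := 1) (R := (m : ℝ)) (u := ax m) (N := 1) (n := 1)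
      le_rfl ω₁_mem (fun i hi0 hi1 => absurd hi1 (by omega))
    simpa using this
  exact lt_irrefl _ (h1.trans_lt (ha m hma))

/-! ### §A' The hypothesis `r < R` is redundant (replace by `0 < R`) -/

/-- The crux with `r < R` WEAKENED to `0 < R`. -/
def PosR : Prop :=
  ∃ θ C : ℝ, 0 < θ ∧ ∀ (z : ℂ) (r R : ℝ), 1 ≤ r → 0 < R → ∀ u : Site 2,
    R ≤ dist (Site.toComplex u) z → ∀ N : ℕ, annMass z r R u N ≤ C * (r / R) ^ θ

/-- For `R ≤ r` the open annulus is empty: only walks of length `≤ 1` are counted, so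
`annMass ≤ c₀ + c₁ x_c ≤ 1 + 4 = 5`. -/
theorem annMass_le_five_of_le {r R : ℝ} (hRr : R ≤ r) (z : ℂ) (u : Site 2) (N : ℕ) :
    annMass z r R u N ≤ 5 := by
  classical
  unfold annMass
  have hx : 0 ≤ SAW.criticalFugacity := criticalFugacity_pos.le
  -- the summand vanishes for `n ≥ 2`
  set f : ℕ → ℝ := fun n => ∑ _ω ∈ (SAW.Zd.saws 2 n).filter (fun ω =>
    (∀ i, 0 < i → i < n → r < dist (Site.toComplex (u + ω i)) z ∧
      dist (Site.toComplex (u + ω i)) z < R) ∧ dist (Site.toComplex (u + ω n)) z ≤ r),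
      SAW.criticalFugacity ^ n with hf
  have hf0 : ∀ n, 2 ≤ n → f n = 0 := by
    intro n hn
    rw [hf]
    refine Finset.sum_eq_zero fun ω hω => ?_
    exfalso
    obtain ⟨-, hint, -⟩ := Finset.mem_filter.1 hω
    have := hint 1 one_pos (by omega)
    linarith [this.1, this.2]
  have hfle : ∀ n, f n ≤ (SAW.Zd.count 2 n : ℝ) := by
    intro n
    rw [hf]
    dsimp only
    rw [Finset.sum_const, nsmul_eq_mul]
    calc _ ≤ ((SAW.Zd.saws 2 n).card : ℝ) * SAW.criticalFugacity ^ n :=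
          mul_le_mul_of_nonneg_right (by exact_mod_cast Finset.card_filter_le _ _) (pow_nonneg hx n)
      _ ≤ (SAW.Zd.saws 2 n).card * 1 :=
          mul_le_mul_of_nonneg_left (pow_le_one₀ hx criticalFugacity_le_one) (Nat.cast_nonneg _)
      _ = (SAW.Zd.count 2 n : ℝ) := by rw [mul_one, SAW.Zd.card_saws]
  have hfnn : ∀ n, 0 ≤ f n := fun n => by
    rw [hf]; exact Finset.sum_nonneg fun _ _ => pow_nonneg hx n
  calc ∑ n ∈ Finset.range (N + 1), f n
      = ∑ n ∈ (Finset.range (N + 1)).filter (· < 2), f n := by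
        refine (Finset.sum_subset (Finset.filter_subset _ _) fun n hn hn' => hf0 n ?_).symm
        by_contra hlt
        exact hn' (Finset.mem_filter.2 ⟨hn, by omega⟩)
    _ ≤ ∑ n ∈ Finset.range 2, f n := by
        refine Finset.sum_le_sum_of_subset_of_nonneg (fun n hn => ?_) fun n _ _ => hfnn n
        exact Finset.mem_range.2 (Finset.mem_filter.1 hn).2
    _ = f 0 + f 1 := by simp [Finset.sum_range_succ]
    _ ≤ (SAW.Zd.count 2 0 : ℝ) + (SAW.Zd.count 2 1 : ℝ) := add_le_add (hfle 0) (hfle 1)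
    _ ≤ 1 + 4 := by
        gcongr
        · exact_mod_cast (SAW.Zd.count_zero 2).le
        · exact_mod_cast (SAW.Zd.count_one_le 2).trans (by norm_num)
    _ = 5 := by norm_num

/-- `r < R` may be replaced by `0 < R`: the two forms are equivalent. -/
theorem annularMassDecay_iff_posR : AnnularMassDecay ↔ PosR := by
  rw [annularMassDecay_iff]
  constructor
  · rintro ⟨θ, C, hθ, h⟩
    refine ⟨θ, max C 5, hθ, fun z r R hr hR u hu N => ?_⟩
    have hrR0 : 0 ≤ (r / R) ^ θ := Real.rpow_nonneg (div_nonneg (by linarith) hR.le) θ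
    rcases lt_or_ge r R with hlt | hge
    · exact (h z r R hr hlt u hu N).trans (mul_le_mul_of_nonneg_right (le_max_left _ _) hrR0)
    · have h1 : (1 : ℝ) ≤ (r / R) ^ θ := Real.one_le_rpow ((one_le_div hR).2 hge) hθ.le
      calc annMass z r R u N ≤ 5 := annMass_le_five_of_le hge z u N
        _ ≤ max C 5 * (r / R) ^ θ := by
          have := le_max_right C 5
          nlinarith
  · rintro ⟨θ, C, hθ, h⟩
    exact ⟨θ, C, hθ, fun z r R hr hrR u hu N => h z r R hr (by linarith) u hu N⟩

/-! ### §B' Tightness at the smallest scale: the constant cannot beat `x_c · 2^θ` -/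

/-- The one-step walk `0 → -e₀`, frozen afterwards. -/
def ω₁' : ℕ → Site 2
  | 0 => ax 0
  | _ => ax (-1)

/-- `ω₁'` is a one-step SAW from `0`. [folklore] -/
theorem ω₁'_mem : ω₁' ∈ SAW.Zd.saws 2 1 := by
  rw [SAW.Zd.mem_saws]
  refine ⟨ax_zero, ?_, ?_, ?_⟩
  · intro i hi
    obtain ⟨k, rfl⟩ := Nat.exists_eq_add_of_le' hi
    rfl
  · intro i hi
    interval_cases i
    show (zdGraph 2).Adj (ax 0) (ax (-1))
    rw [zdGraph_adj_iff]; exact ⟨0, Or.inr (by funext j; fin_cases j <;> simp [ax])⟩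
  · intro i hi j hj h
    simp only [Set.mem_setOf_eq] at hi hj
    have key : ∀ i ≤ 1, ∀ j ≤ 1, ω₁' i 0 = ω₁' j 0 → i = j := by decide
    exact key i hi j hj (by rw [h])

/-- The smallest configuration already forces `C ≥ x_c · 2^θ ≈ 0.379 · 2^θ`: at `z = 0`, `r = 1`,
`R = 2`, `u = (2,0)` the single step `(2,0) → (1,0)` is an annular bridge of mass `x_c`
(corner entries give `2 x_c`, the largest mass found numerically, §D; that family only yields `C ≥ 2x_c`). [folklore] -/
theorem const_ge_of_bound {θ C : ℝ}
    (h : ∀ (z : ℂ) (r R : ℝ), 1 ≤ r → r < R → ∀ u : Site 2, R ≤ dist (Site.toComplex u) z →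
      ∀ N : ℕ, annMass z r R u N ≤ C * (r / R) ^ θ) :
    SAW.criticalFugacity * 2 ^ θ ≤ C := by
  have hu : (2 : ℝ) ≤ dist (Site.toComplex (ax 2)) 0 := by rw [dist_ax_zero]; norm_num
  have h1 := h 0 1 2 le_rfl (by norm_num) (ax 2) hu 1
  have h2 : SAW.criticalFugacity ^ 1 ≤ annMass 0 1 2 (ax 2) 1 :=
    pow_le_annMass le_rfl ω₁'_mem (fun i hi0 hi1 => absurd hi1 (by omega))
      (by
        show dist (Site.toComplex (ax 2 + ax (-1))) 0 ≤ 1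
        rw [ax_add, dist_ax_zero]; norm_num)
  rw [pow_one] at h2
  have h3 : SAW.criticalFugacity ≤ C * (1 / 2) ^ θ := h2.trans h1
  have h4 : (0 : ℝ) < 2 ^ θ := Real.rpow_pos_of_pos two_pos θ
  have h5 : (1 / 2 : ℝ) ^ θ * 2 ^ θ = 1 := by
    rw [← Real.mul_rpow (by norm_num) (by norm_num)]; norm_num
  calc SAW.criticalFugacity * 2 ^ θ ≤ C * (1 / 2) ^ θ * 2 ^ θ :=
        mul_le_mul_of_nonneg_right h3 h4.le
    _ = C := by rw [mul_assoc, h5, mul_one]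

/-! ### §G Translation covariance (reduction to `z ∈ [0,1)²` for provers) -/

/-- `toComplex` is additive. [folklore] -/
theorem toComplex_add (x y : Site 2) :
    Site.toComplex (x + y) = Site.toComplex x + Site.toComplex y := by
  apply Complex.ext <;> simp [Site.toComplex]

/-- Translating the centre and the start by the same lattice vector does not change the annular mass;
so in the crux one may assume `z ∈ [0,1)²` (or `u = 0`). [folklore] -/
theorem annMass_translate (z : ℂ) (r R : ℝ) (u v : Site 2) (N : ℕ) :
    annMass (z + Site.toComplex v) r R (u + v) N = annMass z r R u N := by
  unfold annMass
  refine Finset.sum_congr rfl fun n _ => ?_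
  have key : ∀ (ω : ℕ → Site 2) (i : ℕ),
      dist (Site.toComplex (u + v + ω i)) (z + Site.toComplex v) = dist (Site.toComplex (u + ω i)) z := by
    intro ω i
    rw [show u + v + ω i = (u + ω i) + v by abel, toComplex_add, dist_add_right]
  simp only [key]

/-! ## §A'' (cycle 2) The inner-avoidance clause is load-bearing: `H(x_c) = ∞`

Dropping the inner half `r < dist (u + ω i) z` of the annulus clause (interior vertices may enter the
target disc; outer confinement and the endpoint clause kept) makes the statement FALSE.  Mechanism:
at `z = 0`, `R = m`, `r = m - 1`, `u = (m,0)` every half-plane walk of length `≤ √m`, reflected and hung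
below the first inward step, is counted, and the half-plane generating function diverges at `x_c`
(`c_n x_c^n ≥ 1` and `c_n ≤ Σ_m h_{m+1} h_{n-m}`, Madras–Slade (3.1.12) / Cor. 3.1.8).  Landed copy:
`Theorems/AnnularMassDecay/Negative/AvoidInner.lean` (same names, namespace `…Negative`). -/

/-! ### The half-plane generating function diverges at `x_c` -/

/-- `H_K := Σ_{k ≤ K} h_k x_c^k`, partial sums of the half-plane generating function at `x_c`
(`h_k = SAW.Zd.halfSpaceCount 2 k`). [cite: MadrasSlade1993, Definition 3.1.2] -/
def halfPlanePartialSum (K : ℕ) : ℝ :=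
  ∑ k ∈ Finset.range (K + 1), (SAW.Zd.halfSpaceCount 2 k : ℝ) * SAW.criticalFugacity ^ k

/-- `H_K ≥ 0`. [folklore] -/
theorem halfPlanePartialSum_nonneg (K : ℕ) : 0 ≤ halfPlanePartialSum K :=
  Finset.sum_nonneg fun _ _ => mul_nonneg (Nat.cast_nonneg _) (pow_nonneg criticalFugacity_pos.le _)

/-- `H` is monotone in `K`. [folklore] -/
theorem halfPlanePartialSum_mono {K L : ℕ} (h : K ≤ L) :
    halfPlanePartialSum K ≤ halfPlanePartialSum L :=
  Finset.sum_le_sum_of_subset_of_nonneg (Finset.range_mono (Nat.succ_le_succ h))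
    fun _ _ _ => mul_nonneg (Nat.cast_nonneg _) (pow_nonneg criticalFugacity_pos.le _)

/-- `c_n x_c^n ≥ 1` (`μ^n ≤ c_n`, `x_c = 1/μ`). [cite: MadrasSlade1993, §1.2, eq. (1.2.10)] -/
theorem one_le_count_mul_pow (n : ℕ) :
    (1 : ℝ) ≤ (SAW.Zd.count 2 n : ℝ) * SAW.criticalFugacity ^ n := by
  have hμ : 0 < SAW.Zd.connectiveConstant 2 := SAW.Zd.connectiveConstant_pos 2
  have h := SAW.Zd.pow_connectiveConstant_le_count 2 n
  have hx : SAW.criticalFugacity = (SAW.Zd.connectiveConstant 2)⁻¹ := by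
    rw [← SAW.Zd.criticalPoint_two]; rfl
  rw [hx, inv_pow]
  rw [le_mul_inv_iff₀ (pow_pos hμ n), one_mul]
  exact h

/-- Exchange of a triangular double sum against a product of partial sums (nonnegative terms):
`Σ_{n ≤ M} Σ_{m ≤ n} F(m+1) G(n-m) ≤ (Σ_{j ≤ M+1} F j) (Σ_{k ≤ M} G k)`. [folklore] -/
theorem triangle_sum_le (F G : ℕ → ℝ) (hF : ∀ n, 0 ≤ F n) (hG : ∀ n, 0 ≤ G n) (M : ℕ) :
    ∑ n ∈ Finset.range (M + 1), ∑ m ∈ Finset.range (n + 1), F (m + 1) * G (n - m) ≤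
      (∑ j ∈ Finset.range (M + 2), F j) * ∑ k ∈ Finset.range (M + 1), G k := by
  have hswap : ∑ n ∈ Finset.range (M + 1), ∑ m ∈ Finset.range (n + 1), F (m + 1) * G (n - m) =
      ∑ m ∈ Finset.range (M + 1), ∑ n ∈ Finset.Ico m (M + 1), F (m + 1) * G (n - m) := by
    refine Finset.sum_comm' fun n m => ?_
    simp only [Finset.mem_range, Finset.mem_Ico]
    omega
  rw [hswap]
  have hGsum : 0 ≤ ∑ k ∈ Finset.range (M + 1), G k := Finset.sum_nonneg fun k _ => hG k
  calc ∑ m ∈ Finset.range (M + 1), ∑ n ∈ Finset.Ico m (M + 1), F (m + 1) * G (n - m)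
      = ∑ m ∈ Finset.range (M + 1), F (m + 1) * ∑ k ∈ Finset.range (M + 1 - m), G k := by
        refine Finset.sum_congr rfl fun m _ => ?_
        rw [Finset.mul_sum, Finset.sum_Ico_eq_sum_range]
        refine Finset.sum_congr rfl fun k _ => ?_
        rw [Nat.add_sub_cancel_left]
    _ ≤ ∑ m ∈ Finset.range (M + 1), F (m + 1) * ∑ k ∈ Finset.range (M + 1), G k := by
        refine Finset.sum_le_sum fun m _ => mul_le_mul_of_nonneg_left ?_ (hF _)
        exact Finset.sum_le_sum_of_subset_of_nonneg (Finset.range_mono (Nat.sub_le (M + 1) m))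
          fun k _ _ => hG k
    _ = (∑ m ∈ Finset.range (M + 1), F (m + 1)) * ∑ k ∈ Finset.range (M + 1), G k := by
        rw [Finset.sum_mul]
    _ ≤ (∑ j ∈ Finset.range (M + 2), F j) * ∑ k ∈ Finset.range (M + 1), G k := by
        refine mul_le_mul_of_nonneg_right ?_ hGsum
        rw [Finset.sum_range_succ' F (M + 1)]
        linarith [hF 0]

/-- `Σ_{n ≤ M} c_n x_c^n ≤ x_c⁻¹ · H_{M+1} · H_M` (Madras–Slade (3.1.7)/(3.1.12): cut at the last
minimum of the first coordinate). [cite: MadrasSlade1993, §3.1, eq. (3.1.12)] -/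
theorem sum_count_mul_pow_le (M : ℕ) :
    ∑ n ∈ Finset.range (M + 1), (SAW.Zd.count 2 n : ℝ) * SAW.criticalFugacity ^ n ≤
      SAW.criticalFugacity⁻¹ * (halfPlanePartialSum (M + 1) * halfPlanePartialSum M) := by
  set x := SAW.criticalFugacity with hxdef
  have hx : 0 < x := criticalFugacity_pos
  set F : ℕ → ℝ := fun j => (SAW.Zd.halfSpaceCount 2 j : ℝ) * x ^ j with hF
  have hF0 : ∀ j, 0 ≤ F j := fun j => mul_nonneg (Nat.cast_nonneg _) (pow_nonneg hx.le _)
  -- termwise: c_n x^n ≤ x⁻¹ Σ_m F(m+1) F(n-m)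
  have hterm : ∀ n, (SAW.Zd.count 2 n : ℝ) * x ^ n ≤
      x⁻¹ * ∑ m ∈ Finset.range (n + 1), F (m + 1) * F (n - m) := by
    intro n
    have hc : (SAW.Zd.count 2 n : ℝ) ≤
        ∑ m ∈ Finset.range (n + 1), (SAW.Zd.halfSpaceCount 2 (m + 1) : ℝ) *
          (SAW.Zd.halfSpaceCount 2 (n - m) : ℝ) := by
      exact_mod_cast SAW.Zd.count_le_sum_halfSpaceCount (d := 2) n
    calc (SAW.Zd.count 2 n : ℝ) * x ^ n
        ≤ (∑ m ∈ Finset.range (n + 1), (SAW.Zd.halfSpaceCount 2 (m + 1) : ℝ) *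
            (SAW.Zd.halfSpaceCount 2 (n - m) : ℝ)) * x ^ n :=
          mul_le_mul_of_nonneg_right hc (pow_nonneg hx.le n)
      _ = x⁻¹ * ∑ m ∈ Finset.range (n + 1), F (m + 1) * F (n - m) := by
          rw [Finset.sum_mul, Finset.mul_sum]
          refine Finset.sum_congr rfl fun m hm => ?_
          rw [Finset.mem_range] at hm
          have hpow : x ^ (m + 1) * x ^ (n - m) = x ^ n * x := by
            rw [← pow_add, show m + 1 + (n - m) = n + 1 by omega, pow_succ]
          simp only [hF]
          field_simp
          rw [mul_assoc, mul_assoc, ← hpow]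
          ring
  calc ∑ n ∈ Finset.range (M + 1), (SAW.Zd.count 2 n : ℝ) * x ^ n
      ≤ ∑ n ∈ Finset.range (M + 1), x⁻¹ * ∑ m ∈ Finset.range (n + 1), F (m + 1) * F (n - m) :=
        Finset.sum_le_sum fun n _ => hterm n
    _ = x⁻¹ * ∑ n ∈ Finset.range (M + 1), ∑ m ∈ Finset.range (n + 1), F (m + 1) * F (n - m) := by
        rw [Finset.mul_sum]
    _ ≤ x⁻¹ * ((∑ j ∈ Finset.range (M + 2), F j) * ∑ k ∈ Finset.range (M + 1), F k) :=
        mul_le_mul_of_nonneg_left (triangle_sum_le F F hF0 hF0 M) (inv_nonneg.2 hx.le)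
    _ = x⁻¹ * (halfPlanePartialSum (M + 1) * halfPlanePartialSum M) := rfl

/-- **The half-plane generating function diverges at `x_c`**: its partial sums are unbounded
(Madras–Slade Corollary 3.1.8, `H(z_c) = ∞`, finitary form). [cite: MadrasSlade1993, Corollary 3.1.8] -/
theorem halfPlanePartialSum_unbounded (B : ℝ) : ∃ K, B < halfPlanePartialSum K := by
  by_contra! h
  have hx : 0 < SAW.criticalFugacity := criticalFugacity_pos
  have hB : 0 ≤ B := (halfPlanePartialSum_nonneg 0).trans (h 0)
  -- `M + 1 ≤ Σ_{n ≤ M} c_n x_c^n ≤ x_c⁻¹ B²` for every `M`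
  have key : ∀ M : ℕ, (M : ℝ) + 1 ≤ SAW.criticalFugacity⁻¹ * (B * B) := by
    intro M
    calc (M : ℝ) + 1 = ∑ n ∈ Finset.range (M + 1), (1 : ℝ) := by simp
      _ ≤ ∑ n ∈ Finset.range (M + 1), (SAW.Zd.count 2 n : ℝ) * SAW.criticalFugacity ^ n :=
          Finset.sum_le_sum fun n _ => one_le_count_mul_pow n
      _ ≤ SAW.criticalFugacity⁻¹ * (halfPlanePartialSum (M + 1) * halfPlanePartialSum M) :=
          sum_count_mul_pow_le M
      _ ≤ SAW.criticalFugacity⁻¹ * (B * B) := by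
          refine mul_le_mul_of_nonneg_left ?_ (inv_nonneg.2 hx.le)
          exact mul_le_mul (h _) (h _) (halfPlanePartialSum_nonneg _) hB
  obtain ⟨M, hM⟩ := exists_nat_gt (SAW.criticalFugacity⁻¹ * (B * B))
  linarith [key M]


/-! ### The variant without inner avoidance -/

/-- The crux's double sum with the INNER half of the annulus clause dropped: interior vertices are
only required to lie in the open outer disc `|· - z| < R` (they may enter the target disc). -/
def annMassNoAvoid (z : ℂ) (r R : ℝ) (u : Site 2) (N : ℕ) : ℝ :=
  ∑ n ∈ Finset.range (N + 1), ∑ _ω ∈ (SAW.Zd.saws 2 n).filter (fun ω =>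
    (∀ i, 0 < i → i < n → dist (Site.toComplex (u + ω i)) z < R) ∧
      dist (Site.toComplex (u + ω n)) z ≤ r), SAW.criticalFugacity ^ n

/-- The crux with the inner-avoidance clause `r < dist (u + ω i) z` DROPPED. -/
def WithoutAvoidInner : Prop :=
  ∃ θ C : ℝ, 0 < θ ∧ ∀ (z : ℂ) (r R : ℝ), 1 ≤ r → r < R → ∀ u : Site 2,
    R ≤ dist (Site.toComplex u) z → ∀ N : ℕ, annMassNoAvoid z r R u N ≤ C * (r / R) ^ θ

/-- The walk `ω` reflected in the first coordinate and hung below one step `0 → (-1, 0)`: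
`hang ω 0 = 0`, `hang ω (j+1) = (-1 - ω_j⁰, ω_j¹)`. -/
def hang (ω : ℕ → Site 2) (i : ℕ) : Site 2 :=
  if i = 0 then 0 else ![-1 - ω (i - 1) 0, ω (i - 1) 1]

@[simp] theorem hang_zero (ω : ℕ → Site 2) : hang ω 0 = 0 := by simp [hang]

theorem hang_succ (ω : ℕ → Site 2) (j : ℕ) : hang ω (j + 1) = ![-1 - ω j 0, ω j 1] := by
  simp [hang]

theorem hang_succ_apply_zero (ω : ℕ → Site 2) (j : ℕ) : hang ω (j + 1) 0 = -1 - ω j 0 := by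
  simp [hang_succ]

theorem hang_succ_apply_one (ω : ℕ → Site 2) (j : ℕ) : hang ω (j + 1) 1 = ω j 1 := by
  simp [hang_succ]

/-- `hang` is injective. [folklore] -/
theorem hang_injective : Function.Injective hang := by
  intro ω ω' h
  funext j
  have h0 := congrFun (congrFun h (j + 1)) 0
  have h1 := congrFun (congrFun h (j + 1)) 1
  simp only [hang_succ_apply_zero, hang_succ_apply_one] at h0 h1
  funext t
  fin_cases t
  · show ω j 0 = ω' j 0
    linarith
  · exact h1

/-- A site of `ℤ²` is determined by its two coordinates. [folklore] -/
theorem site_ext {v w : Site 2} (h0 : v 0 = w 0) (h1 : v 1 = w 1) : v = w := by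
  funext t; fin_cases t <;> assumption

/-- For a half-space walk `ω` of length `k`, `hang ω` is a self-avoiding walk of length `k + 1`.
[folklore] -/
theorem hang_mem_saws {k : ℕ} {ω : ℕ → Site 2} (hω : ω ∈ SAW.Zd.halfSpaceWalks 2 k) :
    hang ω ∈ SAW.Zd.saws 2 (k + 1) := by
  rw [SAW.Zd.mem_halfSpaceWalks] at hω
  obtain ⟨hsaw, hhalf⟩ := hω
  obtain ⟨h0, hend, hadj, hinj⟩ := SAW.Zd.mem_saws.1 hsaw
  have h00 : ω 0 0 = 0 := by rw [h0]; rfl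
  -- first coordinates are nonnegative
  have hnn : ∀ j, 0 ≤ ω j 0 := by
    intro j
    rcases Nat.eq_zero_or_pos j with rfl | hj
    · rw [h00]
    · rcases le_or_gt j k with hjk | hjk
      · have := hhalf j hj hjk; rw [h00] at this; exact this.le
      · rw [hend j hjk.le]
        rcases Nat.eq_zero_or_pos k with rfl | hk
        · rw [h00]
        · have := hhalf k hk le_rfl; rw [h00] at this; exact this.le
  rw [SAW.Zd.mem_saws]
  refine ⟨hang_zero ω, ?_, ?_, ?_⟩
  · -- frozen from time `k + 1` on
    intro i hi
    obtain ⟨j, rfl⟩ : ∃ j, i = j + 1 := ⟨i - 1, by omega⟩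
    rw [hang_succ, hang_succ, hend j (by omega)]
  · -- nearest-neighbour steps
    intro i hi
    rcases Nat.eq_zero_or_pos i with rfl | hipos
    · rw [hang_zero, zero_add, hang_succ, h0, zdGraph_adj_iff]
      refine ⟨0, Or.inr ?_⟩
      funext t; fin_cases t <;> simp
    · obtain ⟨j, rfl⟩ : ∃ j, i = j + 1 := ⟨i - 1, by omega⟩
      have hstep := hadj j (by omega)
      rw [zdGraph_adj_iff] at hstep ⊢
      obtain ⟨l, hl | hl⟩ := hstep
      · have hc0 := congrFun hl 0
        have hc1 := congrFun hl 1
        fin_cases l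
        · refine ⟨0, Or.inr (site_ext ?_ ?_)⟩
          · simp only [hang_succ_apply_zero, Pi.add_apply] at hc0 ⊢
            simp at hc0 ⊢; omega
          · simp only [hang_succ_apply_one, Pi.add_apply] at hc1 ⊢
            simp at hc1 ⊢; omega
        · refine ⟨1, Or.inl (site_ext ?_ ?_)⟩
          · simp only [hang_succ_apply_zero, Pi.add_apply] at hc0 ⊢
            simp at hc0 ⊢; omega
          · simp only [hang_succ_apply_one, Pi.add_apply] at hc1 ⊢
            simp at hc1 ⊢; omega
      · have hc0 := congrFun hl 0
        have hc1 := congrFun hl 1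
        fin_cases l
        · refine ⟨0, Or.inl (site_ext ?_ ?_)⟩
          · simp only [hang_succ_apply_zero, Pi.add_apply] at hc0 ⊢
            simp at hc0 ⊢; omega
          · simp only [hang_succ_apply_one, Pi.add_apply] at hc1 ⊢
            simp at hc1 ⊢; omega
        · refine ⟨1, Or.inr (site_ext ?_ ?_)⟩
          · simp only [hang_succ_apply_zero, Pi.add_apply] at hc0 ⊢
            simp at hc0 ⊢; omega
          · simp only [hang_succ_apply_one, Pi.add_apply] at hc1 ⊢
            simp at hc1 ⊢; omega
  · -- self-avoidance
    intro i hi i' hi' heq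
    simp only [Set.mem_setOf_eq] at hi hi'
    rcases Nat.eq_zero_or_pos i with rfl | hipos <;> rcases Nat.eq_zero_or_pos i' with rfl | hi'pos
    · rfl
    · exfalso
      obtain ⟨j', rfl⟩ : ∃ j', i' = j' + 1 := ⟨i' - 1, by omega⟩
      have := congrFun heq 0
      rw [hang_zero, hang_succ_apply_zero] at this
      have h' := hnn j'
      simp at this; omega
    · exfalso
      obtain ⟨j, rfl⟩ : ∃ j, i = j + 1 := ⟨i - 1, by omega⟩
      have := congrFun heq 0
      rw [hang_zero, hang_succ_apply_zero] at this
      have h' := hnn j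
      simp at this; omega
    · obtain ⟨j, rfl⟩ : ∃ j, i = j + 1 := ⟨i - 1, by omega⟩
      obtain ⟨j', rfl⟩ : ∃ j', i' = j' + 1 := ⟨i' - 1, by omega⟩
      have e0 := congrFun heq 0
      have e1 := congrFun heq 1
      rw [hang_succ_apply_zero, hang_succ_apply_zero] at e0
      rw [hang_succ_apply_one, hang_succ_apply_one] at e1
      have hjj : ω j = ω j' := site_ext (by omega) e1
      have := hinj (show j ∈ {i | i ≤ k} by simp; omega) (show j' ∈ {i | i ≤ k} by simp; omega) hjj
      omega

/-- Coordinates and distance of the hung walk started at `(m, 0)`. [folklore] -/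
theorem normSq_ax_add_hang_succ (m : ℤ) (ω : ℕ → Site 2) (j : ℕ) :
    ‖Site.toComplex (ax m + hang ω (j + 1))‖ ^ 2 =
      ((m : ℝ) - 1 - (ω j 0 : ℝ)) ^ 2 + ((ω j 1 : ℝ)) ^ 2 := by
  rw [Complex.sq_norm, Complex.normSq_apply]
  have hre : (Site.toComplex (ax m + hang ω (j + 1))).re = (m : ℝ) - 1 - (ω j 0 : ℝ) := by
    simp [Site.toComplex, ax, hang_succ]; ring
  have him : (Site.toComplex (ax m + hang ω (j + 1))).im = (ω j 1 : ℝ) := by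
    simp [Site.toComplex, ax, hang_succ]
  rw [hre, him]; ring

/-- **Key lower bound.** At `z = 0`, `R = m`, `r = m - 1`, `u = (m, 0)` (`m ≥ 3`), every half-plane
walk of length `k ≤ K` (`K² ≤ m`), hung below the step `(m,0) → (m-1,0)`, is counted by the variant;
hence `x_c · H_K ≤ annMassNoAvoid 0 (m-1) m (m,0) (K+1)`. [folklore] -/
theorem annMassNoAvoid_ge (m K : ℕ) (hm : 3 ≤ m) (hK : K * K ≤ m) :
    SAW.criticalFugacity * halfPlanePartialSum K ≤
      annMassNoAvoid 0 ((m : ℝ) - 1) m (ax m) (K + 1) := by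
  have hx : 0 ≤ SAW.criticalFugacity := criticalFugacity_pos.le
  have hmR : (3 : ℝ) ≤ m := by exact_mod_cast hm
  have hKR : (K : ℝ) * K ≤ m := by exact_mod_cast hK
  unfold annMassNoAvoid halfPlanePartialSum
  rw [Finset.sum_range_succ' _ (K + 1), Finset.mul_sum]
  have htail : 0 ≤ ∑ _ω ∈ (SAW.Zd.saws 2 0).filter (fun ω =>
      (∀ i, 0 < i → i < 0 → dist (Site.toComplex (ax (m : ℤ) + ω i)) 0 < (m : ℝ)) ∧
        dist (Site.toComplex (ax (m : ℤ) + ω 0)) 0 ≤ (m : ℝ) - 1), SAW.criticalFugacity ^ 0 :=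
    Finset.sum_nonneg fun _ _ => pow_nonneg hx 0
  refine le_trans ?_ (le_add_of_nonneg_right htail)
  refine Finset.sum_le_sum fun k hk => ?_
  rw [Finset.mem_range] at hk
  have hkK : k ≤ K := by omega
  -- the counted family at length `k + 1` contains `hang '' (half-space walks of length k)`
  set A := (SAW.Zd.saws 2 (k + 1)).filter (fun ω =>
      (∀ i, 0 < i → i < k + 1 → dist (Site.toComplex (ax (m : ℤ) + ω i)) 0 < (m : ℝ)) ∧
        dist (Site.toComplex (ax (m : ℤ) + ω (k + 1))) 0 ≤ (m : ℝ) - 1) with hA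
  have hsub : (SAW.Zd.halfSpaceWalks 2 k).image hang ⊆ A := by
    intro η hη
    rw [Finset.mem_image] at hη
    obtain ⟨ω, hω, rfl⟩ := hη
    have hω' := hω
    rw [SAW.Zd.mem_halfSpaceWalks] at hω'
    obtain ⟨hsaw, hhalf⟩ := hω'
    obtain ⟨h0, hend, hadj, hinj⟩ := SAW.Zd.mem_saws.1 hsaw
    have h00 : ω 0 0 = 0 := by rw [h0]; rfl
    have habs := SAW.Zd.abs_apply_le_of_adj h0 hadj
    rw [hA, Finset.mem_filter]
    refine ⟨hang_mem_saws hω, fun i hi0 hik => ?_, ?_⟩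
    · -- interior vertex `i = j + 1`, `j < k`: inside the open disc of radius `m`
      obtain ⟨j, rfl⟩ : ∃ j, i = j + 1 := ⟨i - 1, by omega⟩
      have hjk : j ≤ k := by omega
      have ha0 : (0 : ℤ) ≤ ω j 0 := by
        rcases Nat.eq_zero_or_pos j with rfl | hj
        · rw [h00]
        · have := hhalf j hj hjk; rw [h00] at this; exact this.le
      have ha1 : ω j 0 ≤ j := (le_abs_self _).trans (habs j hjk 0)
      have hb : |ω j 1| ≤ j := habs j hjk 1
      have hb1 := (abs_le.1 hb)
      rw [dist_zero_right]
      have hm0 : (0 : ℝ) ≤ m := by linarith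
      refine lt_of_pow_lt_pow_left₀ 2 hm0 ?_
      rw [normSq_ax_add_hang_succ]
      have ha0R : (0 : ℝ) ≤ ω j 0 := by exact_mod_cast ha0
      have ha1R : (ω j 0 : ℝ) ≤ K := by
        have : (ω j 0 : ℝ) ≤ (j : ℝ) := by exact_mod_cast ha1
        have : (j : ℝ) ≤ K := by exact_mod_cast (hjk.trans hkK)
        linarith
      have hbR : -(K : ℝ) ≤ ω j 1 ∧ (ω j 1 : ℝ) ≤ K := by
        have hjK : (j : ℝ) ≤ K := by exact_mod_cast (hjk.trans hkK)
        constructor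
        · have : (-(j : ℤ) : ℝ) ≤ (ω j 1 : ℝ) := by exact_mod_cast hb1.1
          push_cast at this; linarith
        · have : (ω j 1 : ℝ) ≤ (j : ℝ) := by exact_mod_cast hb1.2
          linarith
      have hKm : (K : ℝ) ≤ m := by
        rcases Nat.eq_zero_or_pos K with rfl | hKp
        · simp
        · have : (1 : ℝ) ≤ K := by exact_mod_cast hKp
          nlinarith
      push_cast
      have P1 : (0 : ℝ) ≤ (ω j 0 : ℝ) * (2 * ((m : ℝ) - 1) - (ω j 0 : ℝ)) :=
        mul_nonneg ha0R (by linarith)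
      have P2 : (0 : ℝ) ≤ ((K : ℝ) - (ω j 1 : ℝ)) * ((K : ℝ) + (ω j 1 : ℝ)) :=
        mul_nonneg (by linarith [hbR.2]) (by linarith [hbR.1])
      nlinarith [P1, P2]
    · -- endpoint: inside the closed disc of radius `m - 1`
      rw [dist_zero_right]
      have hm1 : (0 : ℝ) ≤ (m : ℝ) - 1 := by linarith
      refine le_of_pow_le_pow_left₀ two_ne_zero hm1 ?_
      rw [normSq_ax_add_hang_succ]
      rcases Nat.eq_zero_or_pos k with rfl | hkpos
      · rw [h00]
        have : ω 0 1 = 0 := by rw [h0]; rfl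
        rw [this]; push_cast
        nlinarith
      · have ha0 : (1 : ℤ) ≤ ω k 0 := by
          have := hhalf k hkpos le_rfl; rw [h00] at this; omega
        have ha1 : ω k 0 ≤ k := (le_abs_self _).trans (habs k le_rfl 0)
        have hb1 := abs_le.1 (habs k le_rfl 1)
        have ha0R : (1 : ℝ) ≤ ω k 0 := by exact_mod_cast ha0
        have hkKR : (k : ℝ) ≤ K := by exact_mod_cast hkK
        have ha1R : (ω k 0 : ℝ) ≤ K := by
          have : (ω k 0 : ℝ) ≤ (k : ℝ) := by exact_mod_cast ha1
          linarith
        have hbR : -(K : ℝ) ≤ ω k 1 ∧ (ω k 1 : ℝ) ≤ K := by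
          constructor
          · have : (-(k : ℤ) : ℝ) ≤ (ω k 1 : ℝ) := by exact_mod_cast hb1.1
            push_cast at this; linarith
          · have : (ω k 1 : ℝ) ≤ (k : ℝ) := by exact_mod_cast hb1.2
            linarith
        have hKm : (K : ℝ) ≤ m := by
          have : (1 : ℝ) ≤ K := by
            have : 1 ≤ K := le_trans hkpos hkK
            exact_mod_cast this
          nlinarith
        push_cast
        have P1 : (0 : ℝ) ≤ ((ω k 0 : ℝ) - 1) * (2 * (m : ℝ) - 3 - (ω k 0 : ℝ)) :=
          mul_nonneg (by linarith) (by linarith)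
        have P2 : (0 : ℝ) ≤ ((K : ℝ) - (ω k 1 : ℝ)) * ((K : ℝ) + (ω k 1 : ℝ)) :=
          mul_nonneg (by linarith [hbR.2]) (by linarith [hbR.1])
        nlinarith [P1, P2]
  calc SAW.criticalFugacity * ((SAW.Zd.halfSpaceCount 2 k : ℝ) * SAW.criticalFugacity ^ k)
      = ((SAW.Zd.halfSpaceWalks 2 k).image hang).card * SAW.criticalFugacity ^ (k + 1) := by
        rw [Finset.card_image_of_injective _ hang_injective, SAW.Zd.halfSpaceCount, pow_succ]; ring
    _ ≤ A.card * SAW.criticalFugacity ^ (k + 1) := by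
        have : (((SAW.Zd.halfSpaceWalks 2 k).image hang).card : ℝ) ≤ A.card := by
          exact_mod_cast Finset.card_le_card hsub
        exact mul_le_mul_of_nonneg_right this (pow_nonneg hx _)
    _ = ∑ _ω ∈ A, SAW.criticalFugacity ^ (k + 1) := by rw [Finset.sum_const, nsmul_eq_mul]

/-- Any proof of the crux must use the inner-avoidance clause (interior vertices stay OUTSIDE the
target disc): without it, at `z = 0`, `R = m`, `r = m - 1`, `u = (m,0)` the counted mass exceeds
`x_c · H_{⌊√m⌋} → ∞` (`H(x_c) = ∞`, `halfPlanePartialSum_unbounded`), while `C (r/R)^θ ≤ C`. -/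
theorem annularMassDecay_false_without_avoidInner : ¬ WithoutAvoidInner := by
  rintro ⟨θ, C, hθ, h⟩
  have hx : 0 < SAW.criticalFugacity := criticalFugacity_pos
  have hbound : ∀ K : ℕ, SAW.criticalFugacity * halfPlanePartialSum K ≤ max C 0 := by
    intro K
    have hm : 3 ≤ max 3 (K * K) := le_max_left _ _
    have hK : K * K ≤ max 3 (K * K) := le_max_right _ _
    have h1 := annMassNoAvoid_ge (max 3 (K * K)) K hm hK
    set m : ℕ := max 3 (K * K) with hmdef
    have hmR : (3 : ℝ) ≤ m := by exact_mod_cast hm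
    have hu : (m : ℝ) ≤ dist (Site.toComplex (ax (m : ℤ))) 0 := by
      rw [dist_ax_zero]; simp
    have h2 := h 0 ((m : ℝ) - 1) m (by linarith) (by linarith) (ax m) hu (K + 1)
    have hq0 : (0 : ℝ) ≤ ((m : ℝ) - 1) / m := div_nonneg (by linarith) (by linarith)
    have hq1 : ((m : ℝ) - 1) / m ≤ 1 := (div_le_one (by linarith)).2 (by linarith)
    have h3 : (((m : ℝ) - 1) / m) ^ θ ≤ 1 := Real.rpow_le_one hq0 hq1 hθ.le
    have hnn : (0 : ℝ) ≤ (((m : ℝ) - 1) / m) ^ θ := Real.rpow_nonneg hq0 θ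
    have h4 : C * (((m : ℝ) - 1) / m) ^ θ ≤ max C 0 :=
      calc C * (((m : ℝ) - 1) / m) ^ θ ≤ max C 0 * (((m : ℝ) - 1) / m) ^ θ :=
            mul_le_mul_of_nonneg_right (le_max_left _ _) hnn
        _ ≤ max C 0 * 1 := mul_le_mul_of_nonneg_left h3 (le_max_right _ _)
        _ = max C 0 := mul_one _
    linarith
  obtain ⟨K, hK⟩ := halfPlanePartialSum_unbounded (max C 0 / SAW.criticalFugacity)
  have h5 := hbound K
  rw [div_lt_iff₀ hx] at hK
  linarith [mul_comm (halfPlanePartialSum K) SAW.criticalFugacity]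

/-! ## §I (cycle 2) Structure of the sum: far starts vanish, partial sums stabilise

Two reductions for provers (sorry-free; landed copy proposed as `Theorems/AnnularMassDecay/Negative/Structure.lean`):
`annMass_eq_zero_of_far` — starts with `|u - z| ≥ R + 1` contribute nothing, so the sup over `u` runs over
the unit-width ring `R ≤ |u - z| < R + 1`; `annMass_stable` / `annMass_le_annMass_stable` — the partial sums
are constant from `N₀ = (2⌈R⌉ + 3)² + 1` on (interior vertices are distinct lattice points of the disc), so
`∀ N` may be replaced by `N = N₀`: for each `(z, r, R, u)` the crux is a statement about a FINITE family. -/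

/-- The first step of a self-avoiding walk moves the embedded point by distance one. [folklore] -/
theorem dist_first_step {n : ℕ} {ω : ℕ → Site 2} (hω : ω ∈ SAW.Zd.saws 2 n) (hn : 0 < n)
    (u : Site 2) : dist (Site.toComplex (u + ω 1)) (Site.toComplex u) = 1 := by
  obtain ⟨h0, -, hadj, -⟩ := SAW.Zd.mem_saws.1 hω
  have h := hadj 0 hn
  simp only [h0, zero_add] at h
  have h1 : dist (Site.toComplex (0 : Site 2)) (Site.toComplex (ω 1)) = 1 := dist_toComplex_of_adj h
  have hz : Site.toComplex (0 : Site 2) = 0 := by apply Complex.ext <;> simp [Site.toComplex]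
  rw [hz] at h1
  rw [dist_eq_norm, toComplex_add, add_sub_cancel_left, ← dist_zero_right, dist_comm]
  exact h1

/-- **Far starts contribute nothing.** If `|u - z| ≥ R + 1` (and `r < R`), no walk from `u` is
counted: the first step cannot reach the open annulus nor the target disc. So the supremum over the
start `u` in the crux is really over the lattice points of the unit-width ring `R ≤ |u - z| < R + 1`.
[folklore] -/
theorem annMass_eq_zero_of_far {z : ℂ} {r R : ℝ} {u : Site 2} (hrR : r < R)
    (hu : R + 1 ≤ dist (Site.toComplex u) z) (N : ℕ) : annMass z r R u N = 0 := by
  unfold annMass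
  refine Finset.sum_eq_zero fun n _ => Finset.sum_eq_zero fun ω hω => ?_
  exfalso
  obtain ⟨hsaw, hint, hend⟩ := Finset.mem_filter.1 hω
  rcases Nat.eq_zero_or_pos n with rfl | hn
  · -- `n = 0`: the endpoint is `u` itself
    obtain ⟨h0, -, -, -⟩ := SAW.Zd.mem_saws.1 hsaw
    rw [h0, add_zero] at hend
    linarith
  · have h1 := dist_first_step hsaw hn u
    -- `|u + ω 1 - z| ≥ |u - z| - 1 ≥ R`
    have hge : R ≤ dist (Site.toComplex (u + ω 1)) z := by
      have := dist_triangle (Site.toComplex u) (Site.toComplex (u + ω 1)) z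
      rw [dist_comm] at h1
      linarith
    rcases lt_or_ge 1 n with h1n | hn1
    · exact absurd (hint 1 one_pos h1n).2 (not_lt.2 hge)
    · obtain rfl : n = 1 := le_antisymm hn1 hn
      linarith

/-! ### The partial sums stabilise: only finitely many walks are ever counted -/

/-- A lattice box around `z` containing every lattice point of the open disc `|· - z| < R`. -/
def discBox (z : ℂ) (R : ℝ) : Finset (Site 2) :=
  Fintype.piFinset fun j : Fin 2 =>
    Finset.Icc ((if j = 0 then ⌊z.re⌋ else ⌊z.im⌋) - (⌈R⌉₊ : ℤ) - 1)
      ((if j = 0 then ⌊z.re⌋ else ⌊z.im⌋) + (⌈R⌉₊ : ℤ) + 1)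

/-- Lattice points of the open disc `|· - z| < R` lie in `discBox z R`. [folklore] -/
theorem mem_discBox {z : ℂ} {R : ℝ} {v : Site 2} (hv : dist (Site.toComplex v) z < R) :
    v ∈ discBox z R := by
  rw [discBox, Fintype.mem_piFinset]
  have hR : R ≤ (⌈R⌉₊ : ℝ) := Nat.le_ceil R
  have hre : |((v 0 : ℤ) : ℝ) - z.re| < R := by
    have := Complex.abs_re_le_norm (Site.toComplex v - z)
    rw [dist_eq_norm] at hv
    simp only [Complex.sub_re, Site.toComplex_re] at this
    exact this.trans_lt hv
  have him : |((v 1 : ℤ) : ℝ) - z.im| < R := by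
    have := Complex.abs_im_le_norm (Site.toComplex v - z)
    rw [dist_eq_norm] at hv
    simp only [Complex.sub_im, Site.toComplex_im] at this
    exact this.trans_lt hv
  have hfre := Int.floor_le z.re
  have hfre' := Int.lt_floor_add_one z.re
  have hfim := Int.floor_le z.im
  have hfim' := Int.lt_floor_add_one z.im
  intro j
  fin_cases j
  · simp only [Fin.zero_eta, Fin.isValue, ↓reduceIte, Finset.mem_Icc]
    obtain ⟨h1, h2⟩ := abs_lt.1 hre
    constructor
    · have : ((⌊z.re⌋ : ℤ) : ℝ) - (⌈R⌉₊ : ℝ) - 1 < (v 0 : ℝ) := by linarith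
      have : ((⌊z.re⌋ - (⌈R⌉₊ : ℤ) - 1 : ℤ) : ℝ) < ((v 0 : ℤ) : ℝ) := by push_cast; linarith
      exact (Int.cast_lt.1 this).le
    · have : ((v 0 : ℤ) : ℝ) < ((⌊z.re⌋ + (⌈R⌉₊ : ℤ) + 1 : ℤ) : ℝ) := by push_cast; linarith
      exact (Int.cast_lt.1 this).le
  · simp only [Fin.mk_one, Fin.isValue, one_ne_zero, ↓reduceIte, Finset.mem_Icc]
    obtain ⟨h1, h2⟩ := abs_lt.1 him
    constructor
    · have : ((⌊z.im⌋ - (⌈R⌉₊ : ℤ) - 1 : ℤ) : ℝ) < ((v 1 : ℤ) : ℝ) := by push_cast; linarith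
      exact (Int.cast_lt.1 this).le
    · have : ((v 1 : ℤ) : ℝ) < ((⌊z.im⌋ + (⌈R⌉₊ : ℤ) + 1 : ℤ) : ℝ) := by push_cast; linarith
      exact (Int.cast_lt.1 this).le

/-- `#discBox z R = (2⌈R⌉ + 3)²`. [folklore] -/
theorem card_discBox (z : ℂ) (R : ℝ) : (discBox z R).card = (2 * ⌈R⌉₊ + 3) ^ 2 := by
  rw [discBox, Fintype.card_piFinset]
  simp only [Int.card_Icc]
  rw [Fin.prod_univ_two]
  simp only [Fin.isValue, ↓reduceIte, one_ne_zero]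
  have h : ∀ c : ℤ, (c + (⌈R⌉₊ : ℤ) + 1 + 1 - (c - (⌈R⌉₊ : ℤ) - 1)).toNat = 2 * ⌈R⌉₊ + 3 := by
    intro c; omega
  rw [h, h]; ring

/-- A counted walk has at most `#discBox + 1` steps: its interior vertices are distinct lattice points
of the open disc. [folklore] -/
theorem length_le_of_counted {z : ℂ} {r R : ℝ} {u : Site 2} {n : ℕ} {ω : ℕ → Site 2}
    (hω : ω ∈ SAW.Zd.saws 2 n)
    (hint : ∀ i, 0 < i → i < n → r < dist (Site.toComplex (u + ω i)) z ∧
      dist (Site.toComplex (u + ω i)) z < R) :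
    n ≤ (2 * ⌈R⌉₊ + 3) ^ 2 + 1 := by
  obtain ⟨-, -, -, hinj⟩ := SAW.Zd.mem_saws.1 hω
  -- the interior times `1, …, n-1` inject into the box
  have hmaps : ∀ i ∈ Finset.Ioo 0 n, u + ω i ∈ discBox z R := by
    intro i hi
    rw [Finset.mem_Ioo] at hi
    exact mem_discBox (hint i hi.1 hi.2).2
  have hinj' : Set.InjOn (fun i => u + ω i) (Finset.Ioo 0 n : Set ℕ) := by
    intro i hi j hj h
    have hi' : i ∈ {i | i ≤ n} := by
      simp only [Finset.coe_Ioo, Set.mem_Ioo] at hi; simp only [Set.mem_setOf_eq]; omega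
    have hj' : j ∈ {i | i ≤ n} := by
      simp only [Finset.coe_Ioo, Set.mem_Ioo] at hj; simp only [Set.mem_setOf_eq]; omega
    exact hinj hi' hj' (add_left_cancel h)
  have hcard := Finset.card_le_card_of_injOn (fun i => u + ω i) hmaps hinj'
  rw [card_discBox, Nat.card_Ioo] at hcard
  omega

/-- **The partial sums stabilise.** For `N ≥ N₀ := (2⌈R⌉ + 3)² + 1` the crux's partial sum no
longer changes: `∀ N` in the crux may be replaced by the single value `N₀` (the statement is about a
FINITE family of walks for each `z, r, R, u`). [folklore] -/
theorem annMass_stable (z : ℂ) (r R : ℝ) (u : Site 2) {N : ℕ} (hN : (2 * ⌈R⌉₊ + 3) ^ 2 + 1 ≤ N) :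
    annMass z r R u N = annMass z r R u ((2 * ⌈R⌉₊ + 3) ^ 2 + 1) := by
  unfold annMass
  symm
  refine Finset.sum_subset (Finset.range_mono (by omega)) fun n hn hn' => ?_
  rw [Finset.mem_range] at hn hn'
  refine Finset.sum_eq_zero fun ω hω => ?_
  exfalso
  obtain ⟨hsaw, hint, -⟩ := Finset.mem_filter.1 hω
  have := length_le_of_counted hsaw hint
  omega

/-- Consequently the supremum over `N` is a maximum, attained at `N₀`. [folklore] -/
theorem annMass_le_annMass_stable (z : ℂ) (r R : ℝ) (u : Site 2) (N : ℕ) :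
    annMass z r R u N ≤ annMass z r R u ((2 * ⌈R⌉₊ + 3) ^ 2 + 1) := by
  rcases le_or_gt ((2 * ⌈R⌉₊ + 3) ^ 2 + 1) N with h | h
  · exact (annMass_stable z r R u h).le
  · unfold annMass
    exact Finset.sum_le_sum_of_subset_of_nonneg (Finset.range_mono (by omega))
      fun n _ _ => Finset.sum_nonneg fun _ _ => pow_nonneg criticalFugacity_pos.le n

end

end Summit.CriticalPhenomena.SAWScalingLimit.Cruxes.AnnularMassDecay.Disproof
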